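import Summits.BirchSwinnertonDyer.BirchSwinnertonDyer.Theses.SignedLowerHalves
import Summits.BirchSwinnertonDyer.BirchSwinnertonDyer.Theorems.SignedLowerHalvesKobayashiLowerHalfLargeImageDeepPoint
import Literature.NumberTheory.EllipticCurves.Rank1Residual.Typed.X6
import Literature.NumberTheory.EllipticCurves.ZywinaCMImageProofs
import HarnessLib

/-!
# Cruxes 2 and 3 of route `SignedLowerHalves` are ONE class-free statement; crux 2
# `KobayashiLowerHalfSemistable` (item stmt-BirchSwinnertonDyer-19000) in ONE-DEEP-POINT form
# (lead `bsd-line-slh-p2` gen 10; `--supports 19000 --as helper`; closes nothing)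

CALIBRATION ONLY (pen rule D34-4 (3): never an input to a skeleton stub, to `closes`, or to a
by-name close of item 19000 or 19001 — that would be circular). The line of record of crux 2 stays
`Cruxes/KobayashiLowerHalfSemistable/Lines/defmu.lean` (four registered stubs); nothing here is one
of them. Imports the route file for the two crux NAMES, the route-independent squeeze
`Theorems/…KobayashiLowerHalfLargeImageDeepPoint.lean` of lead `bsd-line-slh-p1` gen 10, and three
modules for the class bookkeeping (`ClassX6.surj`, `surj(p) ⇒ ¬CM`; `a_p = 0` on X6 is the tree's
`Supersingular.ClassX6.frobeniusTrace_eq_zero`, reused, not restated).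

## §1–§2 (UNCONDITIONAL): items 19000 ∧ 19001 ⟺ one class-free Eisenstein half

Crux 2 `KobayashiLowerHalfSemistable` quantifies over corner X6 (`ss(p) ∧ sst ∧ (5 ≤ p ∨ a_3 = 0)`),
crux 3 `KobayashiLowerHalfLargeImage` over corner X7 (`ss(p) ∧ ¬sst`) with `¬CM`, `a_p = 0`,
`ρ̄_{E,p}` onto. On X6 at an odd `p` all three extra binders are AUTOMATIC and already tree theorems:
`a_p = 0` (Hasse for `p ≥ 5`, the class's own clause at `p = 3`; tree
`Supersingular.ClassX6.frobeniusTrace_eq_zero`), `ρ̄_{E,p}` onto (Serre 1972 Prop. 21 i) + Prop. 12: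
`ClassX6.surj`), and on the X7 side `ρ̄` onto at an odd `p` forbids CM (Zywina 2015 Prop. 1.14:
`WeierstrassCurve.not_hasSurjectiveModNGaloisRep_of_hasCM`, cited inline). Hence
(`lowerHalves_iff_unified`):

  `KobayashiLowerHalfSemistable ∧ KobayashiLowerHalfLargeImage ⟺ ∀ E/ℚ, ∀ odd p of good reduction
   with a_p = 0 and ρ̄_{E,p} onto, ∃ ε, KobayashiLowerDivisibility E p ε`

— the Eisenstein half of Kobayashi's signed main conjecture for one sign on the whole good
supersingular large-image axis, with NO semistability case split, NO `¬CM`, NO `5 ≤ p ∨ a_3 = 0`.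
The two items are the restriction of this one statement to `sst` / `¬sst`.

## §3–§4 (granted four published facts BY NAME): the same statement read at ONE DEEP POINT

Granted Kobayashi 2003 Thm. 1.2 (`h12`), Thm. 4.1 (`h41`) and the period-unit facts
`realPeriodRat_eq_unit_mul_plusPeriod` (`h5`) / `…_three` (`h3`) — four conjuncts of the route's
`PublishedSignedInputs` —, slh-p1's class-agnostic squeeze
`LargeImageDeepPoint.kobayashiLowerDivisibility_iff_deepPoint` (odd good `p`, `a_p = 0`, `ρ̄` onto)
applies VERBATIM on X6, so crux 2 is equivalent to its class-wide ONE-DEEP-POINT form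
(`kobayashiLowerHalfSemistable_iff_deepPoint`): at every X6 pair with `p ≠ 2`, for some sign `ε`,
every admissible `(κ, γ, f, ϖ, (L⁺,L⁻), D)` admits `n ≥ 1` with `Φ_n ∤ L^ε_p` and `g, h, c ∈ Λ`
with `char X^ε = (g)`, `ι(g + Φ_n·c) = ϖ·ι(L^ε_p·h)` (`Φ_n = Φ_{pⁿ}(1+T)`; the body is VERBATIM the
one of `…LargeImageDeepPointCrux.lean`, i.e. the line predicate
`RohrlichSqueeze.DeepPointLowerDivisibility` of crux 3's line `rohrlich_squeeze`). The direction
crux ⟹ deep point is UNCONDITIONAL. And BOTH cruxes follow from ONE class-free deep-point statement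
(`lowerHalves_of_deepPoint_unified`, `lowerHalves_iff_deepPoint_unified`).

## §5 The defmu line's `p = 3` residual in the same currency

`threeResidual_of_deepPoint`: the registered stub `stub_threeResidual` of `Lines/defmu.lean`
(signature VERBATIM: `∀ W, ClassX6 W 3 → ∃ ε, KobayashiLowerDivisibility W 3 ε`) follows from the
one-deep-point statement on X6 at `p = 3` — Kato's integrality at `3` is the tree theorem
`surjective_pow_of_surj_of_good` under `surj(3)`, which X6 supplies (`a_3 = 0` is the class clause).
So in deep-point currency the `p = 3` sub-corner of X6 is NOT a separate kind of obligation.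

READING (honest). All of this RELOCATES the crux; it does not shrink it: the one-deep-point statement
is the Eisenstein (non-Kato) divisibility at one height-one prime `(Φ_n)` of `Λ`, open in print on
X6 exactly as the crux is (BSTW arXiv:2409.01350 Thm. 1.3 claims the crux itself at `p ≥ 5` under its
scope; PRE). What the kernel now records: (i) items 19000 and 19001 are one statement cut along
`sst`/`¬sst`; (ii) any single layer `n ≥ 1`, either sign, every odd `p` including X6's `p = 3`
sub-corner, suffices for both. L0 of this lead is UNCHANGED (line of record `defmu`).
No summit statement is proved by this file; BSD, crux 2 and crux 3 are NOT proved by any of this.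

References: [Kobayashi2003] Thm. 1.2, Thm. 4.1, Conjecture (p. 2); [Serre1972] §1.11 Prop. 12,
§5.4 Prop. 21 i); [Zywina2015] Prop. 1.14; [Pollack2003] Cor. 5.11; [Washington1997] Prop. 7.2,
§7.1; [Wuthrich2014] Lemma 20; [BurungaleSkinnerTianWan2024] §1.2.1 (h4).
-/

set_option autoImplicit false
-- single-problem summit (D-0017): the doubled namespace component `BirchSwinnertonDyer` is by design
set_option linter.dupNamespace false

noncomputable section

open scoped Classical MatrixGroups ModularForm

open CongruenceSubgroup Polynomial WeierstrassCurve Literature.NumberTheory.EllipticCurves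
  Literature.NumberTheory.EllipticCurves.ModularForms
  Literature.NumberTheory.EllipticCurves.Rank1Residual
  Literature.NumberTheory.EllipticCurves.Kobayashi2003 ZpExtension
  Summit.BirchSwinnertonDyer.Rank1Residual.Supersingular
  Summit.BirchSwinnertonDyer.BirchSwinnertonDyer.Theorems
  Summit.BirchSwinnertonDyer.BirchSwinnertonDyer.Theses.SignedLowerHalves

namespace Summit.BirchSwinnertonDyer.BirchSwinnertonDyer.Theorems.SemistableDeepPointCrux

/-! ## §1 Class bookkeeping (the crux binders from `good ∧ a_p = 0`; `a_p = 0` / `surj` / `¬CM` on the classes are tree theorems, cited at use) -/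

section Bookkeeping

variable (W : WeierstrassCurve ℚ) [W.IsGloballyMinimal] (p : ℕ) [hp : Fact p.Prime]

/-- **Good `p` odd with `a_p = 0` and `E` semistable ⇒ corner X6**: `ss(p)` from `p ∣ 0`, and the
clause `5 ≤ p ∨ a_3 = 0` from `p ∈ {3} ∪ [5, ∞)` (odd prime) resp. `a_3 = a_p = 0`.
[cite: Serre1972, §1.11 Prop. 12 (shape of the class only)] -/
theorem classX6_of_good_of_frobeniusTrace_eq_zero (hp2 : p ≠ 2) (hgood : W.HasGoodReductionAtPrime p)
    (hap : W.frobeniusTrace p = 0) (hsst : Semistable W) : ClassX6 W p := by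
  refine ⟨⟨hgood, by rw [hap]; exact dvd_zero _⟩, hsst, ?_⟩
  by_cases h3 : p = 3
  · subst h3; exact Or.inr hap
  · exact Or.inl (hp.out.five_le_of_ne_two_of_ne_three hp2 h3)

/-- **Good `p` with `a_p = 0` and `E` NOT semistable ⇒ corner X7.** [cite: Serre1972, §1.11 Prop. 12 (shape of the class only)] -/
theorem classX7_of_good_of_frobeniusTrace_eq_zero (hgood : W.HasGoodReductionAtPrime p)
    (hap : W.frobeniusTrace p = 0) (hns : ¬ Semistable W) : ClassX7 W p :=
  ⟨⟨hgood, by rw [hap]; exact dvd_zero _⟩, hns⟩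

end Bookkeeping

/-! ## §2 Items 19000 ∧ 19001 ⟺ ONE class-free Eisenstein half (UNCONDITIONAL) -/

/-- **Cruxes 2 ∧ 3 ⟹ the class-free statement**: at every odd good `p` with `a_p = 0` and `ρ̄_{E,p}`
onto there is a sign with the Eisenstein half — semistable pairs are X6 (crux 2), the others X7 with
`¬CM` automatic from `surj(p)` (crux 3). [cite: Serre1972, §5.4 Prop. 21 i)] [cite: Zywina2015, Prop. 1.14] -/
theorem unified_of_lowerHalves (h2 : KobayashiLowerHalfSemistable) (h3 : KobayashiLowerHalfLargeImage) :
    ∀ (W : WeierstrassCurve ℚ) [W.IsElliptic] [W.IsGloballyMinimal] (p : ℕ) [Fact p.Prime],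
      p ≠ 2 → W.HasGoodReductionAtPrime p → W.frobeniusTrace p = 0 → Surj W p →
      ∃ ε : ℤˣ, KobayashiLowerDivisibility W p ε := by
  intro W _ _ p _ hp2 hgood hap hs
  by_cases hsst : Semistable W
  · exact h2 W p hp2 (classX6_of_good_of_frobeniusTrace_eq_zero W p hp2 hgood hap hsst)
  · exact h3 W p hp2 (classX7_of_good_of_frobeniusTrace_eq_zero W p hgood hap hsst)
      (fun hcm ↦ not_hasSurjectiveModNGaloisRep_of_hasCM W hcm (Fact.out : p.Prime) hp2 hs) hap hs

/-- **The class-free statement ⟹ crux 2 `KobayashiLowerHalfSemistable` BY NAME** (X6 at an odd `p`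
has good `p`, `a_p = 0`, `ρ̄` onto — `ClassX6.surj`). [cite: Serre1972, §5.4 Prop. 21 i) and §1.11 Prop. 12] -/
theorem kobayashiLowerHalfSemistable_of_unified
    (hU : ∀ (W : WeierstrassCurve ℚ) [W.IsElliptic] [W.IsGloballyMinimal] (p : ℕ) [Fact p.Prime],
      p ≠ 2 → W.HasGoodReductionAtPrime p → W.frobeniusTrace p = 0 → Surj W p →
      ∃ ε : ℤˣ, KobayashiLowerDivisibility W p ε) :
    KobayashiLowerHalfSemistable := by
  intro W _ _ p _ hp2 hX
  exact hU W p hp2 hX.1.1 (ClassX6.frobeniusTrace_eq_zero W p hp2 hX) (ClassX6.surj W p hp2 hX)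

/-- **The class-free statement ⟹ crux 3 `KobayashiLowerHalfLargeImage` BY NAME** (its binders are a
sub-case). [cite: Kobayashi2003, Conjecture (p. 2)] -/
theorem kobayashiLowerHalfLargeImage_of_unified
    (hU : ∀ (W : WeierstrassCurve ℚ) [W.IsElliptic] [W.IsGloballyMinimal] (p : ℕ) [Fact p.Prime],
      p ≠ 2 → W.HasGoodReductionAtPrime p → W.frobeniusTrace p = 0 → Surj W p →
      ∃ ε : ℤˣ, KobayashiLowerDivisibility W p ε) :
    KobayashiLowerHalfLargeImage := by
  intro W _ _ p _ hp2 hX _ hap hs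
  exact hU W p hp2 hX.1.1 hap hs

/-- **EQUIVALENCE (UNCONDITIONAL): items 19000 ∧ 19001 ⟺ the Eisenstein half of Kobayashi's signed
main conjecture for one sign at EVERY odd good prime with `a_p = 0` and `ρ̄_{E,p}` onto** — no
semistability split, no `¬CM`, no `5 ≤ p ∨ a_3 = 0`. The two cruxes are this one statement
restricted to `sst` / `¬sst`. Calibration only (never an input to a close of either item).
[cite: Serre1972, §5.4 Prop. 21 i) and §1.11 Prop. 12] [cite: Zywina2015, Prop. 1.14]
[cite: Kobayashi2003, Conjecture (p. 2)] -/
theorem lowerHalves_iff_unified :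
    (KobayashiLowerHalfSemistable ∧ KobayashiLowerHalfLargeImage) ↔
    ∀ (W : WeierstrassCurve ℚ) [W.IsElliptic] [W.IsGloballyMinimal] (p : ℕ) [Fact p.Prime],
      p ≠ 2 → W.HasGoodReductionAtPrime p → W.frobeniusTrace p = 0 → Surj W p →
      ∃ ε : ℤˣ, KobayashiLowerDivisibility W p ε :=
  ⟨fun h ↦ unified_of_lowerHalves h.1 h.2,
    fun hU ↦ ⟨kobayashiLowerHalfSemistable_of_unified hU, kobayashiLowerHalfLargeImage_of_unified hU⟩⟩

/-! ## §3 Crux 2 in ONE-DEEP-POINT form (granted `h12`, `h41`, `h5`, `h3` BY NAME) -/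

/-- **Crux 2 ⟸ the class-wide one-deep-point statement on X6, every odd `p`** (granted `h12`, `h41`,
`h5`, `h3` BY NAME). The hypothesis `hA` is, pair by pair, `∃ ε, RohrlichSqueeze.DeepPointLowerDivisibility W p ε`
with its body written out; the conclusion is the route decl `KobayashiLowerHalfSemistable` BY NAME.
Uses slh-p1's class-agnostic squeeze with `a_p = 0` and `surj(p)` supplied by the class.
[cite: Kobayashi2003, Thm. 1.2, Thm. 4.1 and Conjecture (p. 2)] [cite: Washington1997, Prop. 7.2, §7.1]
[cite: Serre1972, §5.4 Prop. 21 i)] [cite: Wuthrich2014, Lemma 20 (p. 399)] -/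
theorem kobayashiLowerHalfSemistable_of_deepPoint (h12 : thm12_signedSelmerDual_finite_torsion)
    (h41 : thm41_signedCharIdeal_divisibility) (h5 : realPeriodRat_eq_unit_mul_plusPeriod)
    (h3 : realPeriodRat_eq_unit_mul_plusPeriod_three)
    (hA : ∀ (W : WeierstrassCurve ℚ) [W.IsElliptic] [W.IsGloballyMinimal] (p : ℕ) [Fact p.Prime],
      p ≠ 2 → ClassX6 W p → ∃ ε : ℤˣ,
      ∀ (κ : ZpExtension ℚ p) (γ : Field.absoluteGaloisGroup ℚ),
        κ.IsCyclotomic → κ.IsTopGenerator γ → IsCyclotomicVariable p γ →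
      ∀ [NeZero (W.conductorNorm ℤ)] (f : CuspForm (Gamma0 (W.conductorNorm ℤ)) 2),
        IsNewformOf W f → ∀ (ϖ : ℚ), (ϖ : ℝ) * W.realPeriodRat = plusPeriod f →
      ∀ (Lplus Lminus : IwasawaAlgebra p), IsPollackPair f p Lplus Lminus →
      ∀ (D : SignedSelmerDualData W κ γ ε),
        ∃ n : ℕ, 1 ≤ n ∧ ¬ (((((cyclotomic (p ^ n) ℤ).comp (X + 1)).map (Int.castRingHom ℤ_[p]) :
          ℤ_[p][X]) : PowerSeries ℤ_[p]) ∣ kobayashiL ε Lplus Lminus) ∧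
          ∃ g h c : IwasawaAlgebra p, D.charIdeal = Ideal.span {g} ∧
            iwasawaToPowerSeries p (g + ((((cyclotomic (p ^ n) ℤ).comp (X + 1)).map
              (Int.castRingHom ℤ_[p]) : ℤ_[p][X]) : PowerSeries ℤ_[p]) * c) =
              PowerSeries.C (ϖ : ℚ_[p]) * iwasawaToPowerSeries p (kobayashiL ε Lplus Lminus * h)) :
    KobayashiLowerHalfSemistable := by
  intro W _ _ p _ hp2 hX
  obtain ⟨ε, hC⟩ := hA W p hp2 hX
  exact ⟨ε, LargeImageDeepPoint.kobayashiLowerDivisibility_of_deepPoint W p h12 h41 h5 h3 hp2 hX.1.1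
    (ClassX6.frobeniusTrace_eq_zero W p hp2 hX) (ClassX6.surj W p hp2 hX) ε hC⟩

/-- **Crux 2 ⟹ the class-wide one-deep-point statement on X6 (UNCONDITIONAL)**: with the crux's own
sign `ε`, `c = 0` at the deep point `n = λ(L^ε_p) + 1`. [cite: Kobayashi2003, Conjecture (p. 2)]
[cite: Pollack2003, Cor. 5.11] [cite: Washington1997, §7.1] -/
theorem deepPoint_of_kobayashiLowerHalfSemistable (hK : KobayashiLowerHalfSemistable) :
    ∀ (W : WeierstrassCurve ℚ) [W.IsElliptic] [W.IsGloballyMinimal] (p : ℕ) [Fact p.Prime],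
      p ≠ 2 → ClassX6 W p → ∃ ε : ℤˣ,
      ∀ (κ : ZpExtension ℚ p) (γ : Field.absoluteGaloisGroup ℚ),
        κ.IsCyclotomic → κ.IsTopGenerator γ → IsCyclotomicVariable p γ →
      ∀ [NeZero (W.conductorNorm ℤ)] (f : CuspForm (Gamma0 (W.conductorNorm ℤ)) 2),
        IsNewformOf W f → ∀ (ϖ : ℚ), (ϖ : ℝ) * W.realPeriodRat = plusPeriod f →
      ∀ (Lplus Lminus : IwasawaAlgebra p), IsPollackPair f p Lplus Lminus →
      ∀ (D : SignedSelmerDualData W κ γ ε),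
        ∃ n : ℕ, 1 ≤ n ∧ ¬ (((((cyclotomic (p ^ n) ℤ).comp (X + 1)).map (Int.castRingHom ℤ_[p]) :
          ℤ_[p][X]) : PowerSeries ℤ_[p]) ∣ kobayashiL ε Lplus Lminus) ∧
          ∃ g h c : IwasawaAlgebra p, D.charIdeal = Ideal.span {g} ∧
            iwasawaToPowerSeries p (g + ((((cyclotomic (p ^ n) ℤ).comp (X + 1)).map
              (Int.castRingHom ℤ_[p]) : ℤ_[p][X]) : PowerSeries ℤ_[p]) * c) =
              PowerSeries.C (ϖ : ℚ_[p]) * iwasawaToPowerSeries p (kobayashiL ε Lplus Lminus * h) := by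
  intro W _ _ p _ hp2 hX
  obtain ⟨ε, hε⟩ := hK W p hp2 hX
  exact ⟨ε, LargeImageDeepPoint.deepPoint_of_kobayashiLowerDivisibility W p hε⟩

/-- **EQUIVALENCE (calibration): crux 2 `KobayashiLowerHalfSemistable` ⟺ its class-wide
ONE-DEEP-POINT form on X6**, granted `h12`, `h41`, `h5`, `h3` BY NAME. Never an input to a stub /
`closes` / by-name close of item 19000 (circular); a record of WHERE the crux may be attacked: one
height-one prime `(Φ_n)` of `Λ`, any `n ≥ 1`, either sign, every odd `p` (X6's `p = 3` sub-corner
included). [cite: Kobayashi2003, Thm. 1.2, Thm. 4.1 and Conjecture (p. 2)]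
[cite: Washington1997, Prop. 7.2, §7.1] [cite: Serre1972, §5.4 Prop. 21 i)] [cite: Pollack2003, Cor. 5.11] -/
theorem kobayashiLowerHalfSemistable_iff_deepPoint (h12 : thm12_signedSelmerDual_finite_torsion)
    (h41 : thm41_signedCharIdeal_divisibility) (h5 : realPeriodRat_eq_unit_mul_plusPeriod)
    (h3 : realPeriodRat_eq_unit_mul_plusPeriod_three) :
    KobayashiLowerHalfSemistable ↔
    ∀ (W : WeierstrassCurve ℚ) [W.IsElliptic] [W.IsGloballyMinimal] (p : ℕ) [Fact p.Prime],
      p ≠ 2 → ClassX6 W p → ∃ ε : ℤˣ,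
      ∀ (κ : ZpExtension ℚ p) (γ : Field.absoluteGaloisGroup ℚ),
        κ.IsCyclotomic → κ.IsTopGenerator γ → IsCyclotomicVariable p γ →
      ∀ [NeZero (W.conductorNorm ℤ)] (f : CuspForm (Gamma0 (W.conductorNorm ℤ)) 2),
        IsNewformOf W f → ∀ (ϖ : ℚ), (ϖ : ℝ) * W.realPeriodRat = plusPeriod f →
      ∀ (Lplus Lminus : IwasawaAlgebra p), IsPollackPair f p Lplus Lminus →
      ∀ (D : SignedSelmerDualData W κ γ ε),
        ∃ n : ℕ, 1 ≤ n ∧ ¬ (((((cyclotomic (p ^ n) ℤ).comp (X + 1)).map (Int.castRingHom ℤ_[p]) :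
          ℤ_[p][X]) : PowerSeries ℤ_[p]) ∣ kobayashiL ε Lplus Lminus) ∧
          ∃ g h c : IwasawaAlgebra p, D.charIdeal = Ideal.span {g} ∧
            iwasawaToPowerSeries p (g + ((((cyclotomic (p ^ n) ℤ).comp (X + 1)).map
              (Int.castRingHom ℤ_[p]) : ℤ_[p][X]) : PowerSeries ℤ_[p]) * c) =
              PowerSeries.C (ϖ : ℚ_[p]) * iwasawaToPowerSeries p (kobayashiL ε Lplus Lminus * h) :=
  ⟨deepPoint_of_kobayashiLowerHalfSemistable, kobayashiLowerHalfSemistable_of_deepPoint h12 h41 h5 h3⟩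

/-! ## §4 BOTH cruxes from ONE class-free deep-point statement (granted the four facts BY NAME) -/

/-- **One class-free deep-point statement ⟹ items 19000 ∧ 19001 BY NAME**: at every odd good `p`
with `a_p = 0` and `ρ̄_{E,p}` onto, for some sign, the Eisenstein divisibility read modulo ONE
cyclotomic point `Φ_n ∤ L^ε_p` (`n ≥ 1`) — granted `h12`, `h41`, `h5`, `h3`. Composition of
slh-p1's squeeze with §2. [cite: Kobayashi2003, Thm. 1.2, Thm. 4.1 and Conjecture (p. 2)]
[cite: Washington1997, Prop. 7.2, §7.1] [cite: Serre1972, §5.4 Prop. 21 i)] [cite: Zywina2015, Prop. 1.14] -/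
theorem lowerHalves_of_deepPoint_unified (h12 : thm12_signedSelmerDual_finite_torsion)
    (h41 : thm41_signedCharIdeal_divisibility) (h5 : realPeriodRat_eq_unit_mul_plusPeriod)
    (h3 : realPeriodRat_eq_unit_mul_plusPeriod_three)
    (hD : ∀ (W : WeierstrassCurve ℚ) [W.IsElliptic] [W.IsGloballyMinimal] (p : ℕ) [Fact p.Prime],
      p ≠ 2 → W.HasGoodReductionAtPrime p → W.frobeniusTrace p = 0 → Surj W p → ∃ ε : ℤˣ,
      ∀ (κ : ZpExtension ℚ p) (γ : Field.absoluteGaloisGroup ℚ),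
        κ.IsCyclotomic → κ.IsTopGenerator γ → IsCyclotomicVariable p γ →
      ∀ [NeZero (W.conductorNorm ℤ)] (f : CuspForm (Gamma0 (W.conductorNorm ℤ)) 2),
        IsNewformOf W f → ∀ (ϖ : ℚ), (ϖ : ℝ) * W.realPeriodRat = plusPeriod f →
      ∀ (Lplus Lminus : IwasawaAlgebra p), IsPollackPair f p Lplus Lminus →
      ∀ (D : SignedSelmerDualData W κ γ ε),
        ∃ n : ℕ, 1 ≤ n ∧ ¬ (((((cyclotomic (p ^ n) ℤ).comp (X + 1)).map (Int.castRingHom ℤ_[p]) :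
          ℤ_[p][X]) : PowerSeries ℤ_[p]) ∣ kobayashiL ε Lplus Lminus) ∧
          ∃ g h c : IwasawaAlgebra p, D.charIdeal = Ideal.span {g} ∧
            iwasawaToPowerSeries p (g + ((((cyclotomic (p ^ n) ℤ).comp (X + 1)).map
              (Int.castRingHom ℤ_[p]) : ℤ_[p][X]) : PowerSeries ℤ_[p]) * c) =
              PowerSeries.C (ϖ : ℚ_[p]) * iwasawaToPowerSeries p (kobayashiL ε Lplus Lminus * h)) :
    KobayashiLowerHalfSemistable ∧ KobayashiLowerHalfLargeImage := by
  refine lowerHalves_iff_unified.mpr fun W _ _ p _ hp2 hgood hap hs ↦ ?_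
  obtain ⟨ε, hC⟩ := hD W p hp2 hgood hap hs
  exact ⟨ε, LargeImageDeepPoint.kobayashiLowerDivisibility_of_deepPoint W p h12 h41 h5 h3 hp2 hgood
    hap hs ε hC⟩

/-- **EQUIVALENCE: items 19000 ∧ 19001 ⟺ ONE class-free deep-point statement** (granted `h12`,
`h41`, `h5`, `h3` BY NAME; the direction ⟹ uses only Pollack's `L^ε_p ≠ 0`). Calibration only.
[cite: Kobayashi2003, Thm. 1.2, Thm. 4.1 and Conjecture (p. 2)] [cite: Pollack2003, Cor. 5.11]
[cite: Washington1997, Prop. 7.2, §7.1] [cite: Serre1972, §5.4 Prop. 21 i)] [cite: Zywina2015, Prop. 1.14] -/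
theorem lowerHalves_iff_deepPoint_unified (h12 : thm12_signedSelmerDual_finite_torsion)
    (h41 : thm41_signedCharIdeal_divisibility) (h5 : realPeriodRat_eq_unit_mul_plusPeriod)
    (h3 : realPeriodRat_eq_unit_mul_plusPeriod_three) :
    (KobayashiLowerHalfSemistable ∧ KobayashiLowerHalfLargeImage) ↔
    ∀ (W : WeierstrassCurve ℚ) [W.IsElliptic] [W.IsGloballyMinimal] (p : ℕ) [Fact p.Prime],
      p ≠ 2 → W.HasGoodReductionAtPrime p → W.frobeniusTrace p = 0 → Surj W p → ∃ ε : ℤˣ,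
      ∀ (κ : ZpExtension ℚ p) (γ : Field.absoluteGaloisGroup ℚ),
        κ.IsCyclotomic → κ.IsTopGenerator γ → IsCyclotomicVariable p γ →
      ∀ [NeZero (W.conductorNorm ℤ)] (f : CuspForm (Gamma0 (W.conductorNorm ℤ)) 2),
        IsNewformOf W f → ∀ (ϖ : ℚ), (ϖ : ℝ) * W.realPeriodRat = plusPeriod f →
      ∀ (Lplus Lminus : IwasawaAlgebra p), IsPollackPair f p Lplus Lminus →
      ∀ (D : SignedSelmerDualData W κ γ ε),
        ∃ n : ℕ, 1 ≤ n ∧ ¬ (((((cyclotomic (p ^ n) ℤ).comp (X + 1)).map (Int.castRingHom ℤ_[p]) :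
          ℤ_[p][X]) : PowerSeries ℤ_[p]) ∣ kobayashiL ε Lplus Lminus) ∧
          ∃ g h c : IwasawaAlgebra p, D.charIdeal = Ideal.span {g} ∧
            iwasawaToPowerSeries p (g + ((((cyclotomic (p ^ n) ℤ).comp (X + 1)).map
              (Int.castRingHom ℤ_[p]) : ℤ_[p][X]) : PowerSeries ℤ_[p]) * c) =
              PowerSeries.C (ϖ : ℚ_[p]) * iwasawaToPowerSeries p (kobayashiL ε Lplus Lminus * h) := by
  refine ⟨fun h W _ _ p _ hp2 hgood hap hs ↦ ?_, lowerHalves_of_deepPoint_unified h12 h41 h5 h3⟩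
  obtain ⟨ε, hε⟩ := unified_of_lowerHalves h.1 h.2 W p hp2 hgood hap hs
  exact ⟨ε, LargeImageDeepPoint.deepPoint_of_kobayashiLowerDivisibility W p hε⟩

/-! ## §5 The defmu line's registered `p = 3` residual in deep-point currency -/

/-- **`stub_threeResidual` of `Lines/defmu.lean` (signature VERBATIM) ⟸ the one-deep-point statement
on X6 at `p = 3`**, granted `h12`, `h41`, `h5`, `h3` BY NAME: Kato's integrality at `3` on X6 is the
tree theorem `surjective_pow_of_surj_of_good` under `surj(3)` (`ClassX6.surj`), so the squeeze holds
at `p = 3` as at `p ≥ 5`; the `p = 3` sub-corner needs no separate kind of engine in this currency.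
Calibration only — NOT a proof of the stub. [cite: Kobayashi2003, Thm. 1.2, Thm. 4.1 and Conjecture (p. 2)]
[cite: Wuthrich2014, Lemma 20 (p. 399)] [cite: Serre1972, §5.4 Prop. 21 i)] -/
theorem threeResidual_of_deepPoint (h12 : thm12_signedSelmerDual_finite_torsion)
    (h41 : thm41_signedCharIdeal_divisibility) (h5 : realPeriodRat_eq_unit_mul_plusPeriod)
    (h3 : realPeriodRat_eq_unit_mul_plusPeriod_three)
    (hD3 : ∀ (W : WeierstrassCurve ℚ) [W.IsElliptic] [W.IsGloballyMinimal],
      ClassX6 W 3 → ∃ ε : ℤˣ,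
      ∀ (κ : ZpExtension ℚ 3) (γ : Field.absoluteGaloisGroup ℚ),
        κ.IsCyclotomic → κ.IsTopGenerator γ → IsCyclotomicVariable 3 γ →
      ∀ [NeZero (W.conductorNorm ℤ)] (f : CuspForm (Gamma0 (W.conductorNorm ℤ)) 2),
        IsNewformOf W f → ∀ (ϖ : ℚ), (ϖ : ℝ) * W.realPeriodRat = plusPeriod f →
      ∀ (Lplus Lminus : IwasawaAlgebra 3), IsPollackPair f 3 Lplus Lminus →
      ∀ (D : SignedSelmerDualData W κ γ ε),
        ∃ n : ℕ, 1 ≤ n ∧ ¬ (((((cyclotomic (3 ^ n) ℤ).comp (X + 1)).map (Int.castRingHom ℤ_[3]) :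
          ℤ_[3][X]) : PowerSeries ℤ_[3]) ∣ kobayashiL ε Lplus Lminus) ∧
          ∃ g h c : IwasawaAlgebra 3, D.charIdeal = Ideal.span {g} ∧
            iwasawaToPowerSeries 3 (g + ((((cyclotomic (3 ^ n) ℤ).comp (X + 1)).map
              (Int.castRingHom ℤ_[3]) : ℤ_[3][X]) : PowerSeries ℤ_[3]) * c) =
              PowerSeries.C (ϖ : ℚ_[3]) * iwasawaToPowerSeries 3 (kobayashiL ε Lplus Lminus * h)) :
    ∀ (W : WeierstrassCurve ℚ) [W.IsElliptic] [W.IsGloballyMinimal],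
      Rank1Residual.ClassX6 W 3 → ∃ ε : ℤˣ,
        Summit.BirchSwinnertonDyer.Rank1Residual.Supersingular.KobayashiLowerDivisibility W 3 ε := by
  intro W _ _ hX
  obtain ⟨ε, hC⟩ := hD3 W hX
  exact ⟨ε, LargeImageDeepPoint.kobayashiLowerDivisibility_of_deepPoint W 3 h12 h41 h5 h3 (by decide)
    hX.1.1 (ClassX6.frobeniusTrace_eq_zero W 3 (by decide) hX) (ClassX6.surj W 3 (by decide) hX) ε hC⟩

end Summit.BirchSwinnertonDyer.BirchSwinnertonDyer.Theorems.SemistableDeepPointCrux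

end
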